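import Summits.HodgeConjecture.HodgeConjecture.Theorems.NikulinTwinTransportTwinSimilitudeAlgebraic
import Summits.HodgeConjecture.HodgeConjecture.Theorems.NikulinTwinTransportTwinSimilitudeAlgebraicMarkings
import Summits.HodgeConjecture.HodgeConjecture.Theorems.NikulinTwinTransportSquareTranscendental
import Literature.AlgebraicGeometry.Surfaces.K3Marking
import Literature.AlgebraicGeometry.HodgeTheory.ComplexGysinCorrespondence
import HarnessLib

/-!
# Route NikulinTwinTransport · crux `TwinSimilitudeAlgebraic` (stmt-HodgeConjecture-13674) —
# stub `stub_inverseAnchorAlgebraic` of line `hyperkaehler-nikulin-anchors` (reshape r6)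

**The inverse of an algebraic out-anchor is algebraic.**  Let `S`, `Σ = Sg` be projective K3
surfaces with integral generators `p`, `pg` of `H⁴`, and let `Ψ : H²(S(ℂ); ℂ) ⥲ H²(Σ(ℂ); ℂ)` be a
`ℂ`-linear equivalence which is the action `x ↦ fst₊(snd^* x ∪ γ)` of an ALGEBRAIC class `γ` on
`Σ ⊗ S` and whose inverse HALVES the cup form (`(u.v) = 2b·pg ⟹ (Ψ⁻¹u.Ψ⁻¹v) = b·p`).  Then
`Ψ⁻¹` is the action of an algebraic class `γ′` on `S ⊗ Σ`.

The statement is registered with its two formal inputs SPELLED OUT as hypotheses (they are the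
neighbouring stubs `stub_topPushProportional`, `stub_corrTranspose` of the line; this file lands
independently of them):

* (T1) the two top-degree push-forwards `fst₊ : H⁸((Σ ⊗ S)(ℂ)) → H⁴(Σ(ℂ))`,
  `snd₊ : H⁸((Σ ⊗ S)(ℂ)) → H⁴(S(ℂ))` are proportional with a non-zero universal constant `κ` read
  in `pg`, `p`;
* (T2) the transpose of `γ` is an algebraic class `γ′` on `S ⊗ Σ` acting as `u ↦ snd₊(fst^* u ∪ γ)`.

Proof (`stub_inverseAnchorAlgebraic`; Fulton, *Young Tableaux*, App. B (5)–(6) for the projection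
formula; Varesco 2023 §2 for "the transpose of a similitude of multiplier `2` is `2` times its
inverse"): mark both surfaces (`Huybrechts_K3_marking_exists`), so that every cup product on `S` is
`(ηa.ηb)·n • p` and on `Σ` is `(η′u.η′v)·n′ • pg` with `n ≠ 0`.  For `x ∈ H²(S)`, `u ∈ H²(Σ)` put
`W := fst^* u ∪ (snd^* x ∪ γ) = snd^* x ∪ (fst^* u ∪ γ) ∈ H⁸((Σ ⊗ S)(ℂ))` (associativity and
graded commutativity in even degrees).  The projection formula gives `fst₊ W = u ∪ Ψx` and
`snd₊ W = x ∪ Φu`, `Φ := [γ′]_*`; so `x ∪ Φu = κ a • p` whenever `u ∪ Ψx = a • pg` (T1), while the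
halving hypothesis applied to `(u, Ψx)` gives `x ∪ Ψ⁻¹u = (a/2) • p`.  Hence `x ∪ (Φu − 2κ Ψ⁻¹u) = 0`
for all `x`, and the non-degeneracy of the K3 form (`k3FormC_nondegenerate`) forces
`Φu = 2κ • Ψ⁻¹u`, i.e. `Ψ⁻¹ = (2κ)⁻¹ • Φ`, the action of the algebraic class `(2κ)⁻¹ • γ′`
(`induced_smul`).

Prover seat prover-line-stmt-HodgeConjecture-13674-c2-0 (line lead c2).

## References

* [FultonYoungTableaux1997] W. Fulton, Young Tableaux, CUP 1997, Appendix B §B.1 (5)–(6).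
* [Varesco2023] M. Varesco, Hodge similarities, algebraic classes, and Kuga–Satake varieties,
  Math. Z. 305 (2023), §2 (proof of Thm. 2.1).
* [Huybrechts2016K3] D. Huybrechts, Lectures on K3 Surfaces, CUP 2016, Ch. 1 Prop. 3.5, Ch. 14 §0.3 (vi).
* [Buskin2019] N. Buskin, J. reine angew. Math. 755 (2019), Lemma 6.3.
-/

noncomputable section

set_option linter.dupNamespace false

open CategoryTheory MonoidalCategory
open scoped Manifold Matrix
open Literature.AlgebraicGeometry.Motives Literature.AlgebraicGeometry.HodgeTheory
open Literature.AlgebraicGeometry.Surfaces Literature.Geometry.Kaehler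
open Literature.AlgebraicTopology.SingularHomology
open Summit.HodgeConjecture.HodgeConjecture.Theses.NikulinTwinTransport

namespace Summit.HodgeConjecture.HodgeConjecture.Theorems.NikulinTwinTransport

/-! ## Local notations — VERBATIM those of the registered skeleton
`Cruxes/TwinSimilitudeAlgebraic/Lines/hyperkaehler_nikulin_anchors.lean` -/

/-- `Gen[S, p]`: `p` is an integral generator of `H⁴(S(ℂ); ℂ)` (the generator clause of X). Local notation
only. -/
local notation3 (prettyPrint := false) "Gen[" S ", " p "]" =>
  (IsIntegralClass p ∧ ∀ q : complexBetti S (2 * 2), IsIntegralClass q → ∃ n : ℤ, q = n • p)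

/-- `Corr[μ, S, S', hS, hS' ; γ, y] = [γ]_* y = fst_*(snd^* y ∪ γ)`, the action of
`γ ∈ H⁴((S ⊗ S′)(ℂ); ℂ)` as a correspondence `H²(S′) → H²(S)` (the FIRST factor receives). Local notation
only, verbatim from the route's Theorems files; for `hS hS'` the K3 witnesses it is definitionally the
inline term of the route items. -/
local notation3 (prettyPrint := false) "Corr[" μ ", " S ", " S' ", " hS ", " hS' " ; " γ ", " y "]" =>
  complexGysin μ
    (IsSmoothProjective.tensor_holds (IsK3Surface.isSmoothProjective hS)
      (IsK3Surface.isSmoothProjective hS'))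
    (IsK3Surface.isSmoothProjective hS) (SemiCartesianMonoidalCategory.fst S S')
    (rfl : 2 * 1 + 2 * 2 + 2 * 2 = 2 * 1 + 2 * (2 + 2))
    (cupProduct (rfl : 2 * 1 + 2 * 2 = 2 * 1 + 2 * 2)
      (complexBetti.map (SemiCartesianMonoidalCategory.snd S S') (2 * 1) y) γ)

/-! ## The stub -/

/-- **The inverse of an algebraic out-anchor is algebraic** (registered stub
`stub_inverseAnchorAlgebraic` of line `hyperkaehler-nikulin-anchors`, reshape r6; hypotheses T1
`TopPushProportional` and T2 `CorrTranspose` spelled out): for projective K3 surfaces `S, Σ` with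
integral generators `p, pg`, a `ℂ`-linear equivalence `Ψ : H²(S) ⥲ H²(Σ)` which is the action of an
algebraic class on `Σ ⊗ S` and whose inverse halves the cup form has an algebraic inverse:
`Ψ⁻¹ = [γ′]_*`, `γ′ ∈ N²H⁴((S ⊗ Σ)(ℂ); ℂ)` — namely `(2κ)⁻¹` times the transpose class, by the
projection formula, the halving identity and the non-degeneracy of the cup form on `H²(S)`.
[cite: FultonYoungTableaux1997, Appendix B §B.1 (5)–(6)] [cite: Varesco2023, §2 (proof of Thm. 2.1)]
[cite: Huybrechts2016K3, Ch. 1 Prop. 3.5 and Ch. 14 §0.3 (vi)] -/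
theorem stub_inverseAnchorAlgebraic :
    (∀ (μ : OrientationFamily), μ.HasPoincareDuality →
      ∀ (S Sg : SchemeOver ℂ) (hS : IsK3Surface S) (hSg : IsK3Surface Sg)
        (p : complexBetti S (2 * 2)) (pg : complexBetti Sg (2 * 2)), p ≠ 0 → pg ≠ 0 →
        ∃ κ : ℂ, κ ≠ 0 ∧
          ∀ (W : complexBetti (MonoidalCategoryStruct.tensorObj Sg S) (2 * (2 + 2))) (a : ℂ),
            complexGysin μ
                (IsSmoothProjective.tensor_holds (IsK3Surface.isSmoothProjective hSg)
                  (IsK3Surface.isSmoothProjective hS))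
                (IsK3Surface.isSmoothProjective hSg) (SemiCartesianMonoidalCategory.fst Sg S)
                (rfl : 2 * (2 + 2) + 2 * 2 = 2 * 2 + 2 * (2 + 2)) W = a • pg →
              complexGysin μ
                (IsSmoothProjective.tensor_holds (IsK3Surface.isSmoothProjective hSg)
                  (IsK3Surface.isSmoothProjective hS))
                (IsK3Surface.isSmoothProjective hS) (SemiCartesianMonoidalCategory.snd Sg S)
                (rfl : 2 * (2 + 2) + 2 * 2 = 2 * 2 + 2 * (2 + 2)) W = (κ * a) • p) →
    (∀ (μ : OrientationFamily), μ.HasPoincareDuality →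
      ∀ (S Sg : SchemeOver ℂ) (hS : IsK3Surface S) (hSg : IsK3Surface Sg),
        ∀ γ ∈ algebraicClasses (MonoidalCategoryStruct.tensorObj Sg S) 2,
          ∃ γ' ∈ algebraicClasses (MonoidalCategoryStruct.tensorObj S Sg) 2,
            ∀ u : complexBetti Sg (2 * 1),
              Corr[μ, S, Sg, hS, hSg ; γ', u] =
                complexGysin μ
                  (IsSmoothProjective.tensor_holds (IsK3Surface.isSmoothProjective hSg)
                    (IsK3Surface.isSmoothProjective hS))
                  (IsK3Surface.isSmoothProjective hS) (SemiCartesianMonoidalCategory.snd Sg S)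
                  (rfl : 2 * 1 + 2 * 2 + 2 * 2 = 2 * 1 + 2 * (2 + 2))
                  (cupProduct (rfl : 2 * 1 + 2 * 2 = 2 * 1 + 2 * 2)
                    (complexBetti.map (SemiCartesianMonoidalCategory.fst Sg S) (2 * 1) u) γ)) →
    Huybrechts_K3_marking_exists →
    ∀ (μ : OrientationFamily), μ.HasPoincareDuality →
      ∀ (S Sg : SchemeOver ℂ) (hS : IsK3Surface S) (hSg : IsK3Surface Sg)
        (p : complexBetti S (2 * 2)) (pg : complexBetti Sg (2 * 2)), Gen[S, p] → Gen[Sg, pg] →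
        ∀ (Ψ : complexBetti S (2 * 1) ≃ₗ[ℂ] complexBetti Sg (2 * 1)),
          (∀ (u v : complexBetti Sg (2 * 1)) (b : ℂ),
            cupProduct (rfl : 2 * 1 + 2 * 1 = 2 * 2) u v = ((2 : ℂ) * b) • pg →
              cupProduct (rfl : 2 * 1 + 2 * 1 = 2 * 2) (Ψ.symm u) (Ψ.symm v) = b • p) →
          (∃ γ ∈ algebraicClasses (MonoidalCategoryStruct.tensorObj Sg S) 2,
            ∀ x : complexBetti S (2 * 1), Ψ x = Corr[μ, Sg, S, hSg, hS ; γ, x]) →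
          ∃ γ' ∈ algebraicClasses (MonoidalCategoryStruct.tensorObj S Sg) 2,
            ∀ u : complexBetti Sg (2 * 1), Ψ.symm u = Corr[μ, S, Sg, hS, hSg ; γ', u] := by
  intro hT hC hmark μ hμ S Sg hS hSg p pg hp hpg Ψ hΨs halg
  obtain ⟨γ, hγ, hΨγ⟩ := halg
  have hS_ : IsSmoothProjective 2 S := IsK3Surface.isSmoothProjective hS
  have hSg_ : IsSmoothProjective 2 Sg := IsK3Surface.isSmoothProjective hSg
  have hTT : IsSmoothProjective (2 + 2) (MonoidalCategoryStruct.tensorObj Sg S) :=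
    IsSmoothProjective.tensor_holds hSg_ hS_
  have hp0 : p ≠ 0 := generator_ne_zero hS hp.2
  have hpg0 : pg ≠ 0 := generator_ne_zero hSg hpg.2
  -- markings of `S` and of `Σ`: every cup product is a multiple of the generator
  obtain ⟨η, p₀, x₀, hp₀, ⟨hp₀int, -, -, hηcup, -, -⟩, -⟩ := hmark S hS
  obtain ⟨η', p₀', x₀', -, ⟨hp₀'int, -, -, hη'cup, -, -⟩, -⟩ := hmark Sg hSg
  clear x₀ x₀'
  obtain ⟨n, hn⟩ := hp.2 p₀ hp₀int
  obtain ⟨n', hn'⟩ := hpg.2 p₀' hp₀'int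
  rw [← Int.cast_smul_eq_zsmul ℂ] at hn hn'
  have hn0 : (n : ℂ) ≠ 0 := by
    intro h0
    apply hp₀
    rw [hn, h0, zero_smul]
  have hcS : ∀ a b : complexBetti S (2 * 1),
      cupProduct (rfl : 2 * 1 + 2 * 1 = 2 * 2) a b = (k3Form (η a) (η b) * (n : ℂ)) • p := by
    intro a b
    rw [hηcup, hn, smul_smul]
  have hcg : ∀ u v : complexBetti Sg (2 * 1),
      cupProduct (rfl : 2 * 1 + 2 * 1 = 2 * 2) u v = (k3Form (η' u) (η' v) * (n' : ℂ)) • pg := by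
    intro u v
    rw [hη'cup, hn', smul_smul]
  -- T1: the proportionality constant `κ`; T2: the transpose class `γ'` and its action `Φ`
  obtain ⟨κ, hκ0, hκ⟩ := hT μ hμ S Sg hS hSg p pg hp0 hpg0
  obtain ⟨γ', hγ', hact⟩ := hC μ hμ S Sg hS hSg γ hγ
  let Φ : complexBetti Sg (2 * 1) →ₗ[ℂ] complexBetti S (2 * 1) :=
    corrAction μ hS_ hSg_ (rfl : 2 * 1 + 2 * 2 = 2 * 1 + 2 * 2) γ'
  have hΦ : ∀ u, Φ u = Corr[μ, S, Sg, hS, hSg ; γ', u] := fun u => rfl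
  -- the two projection formulas on the same top class: `x ∪ Φ u = κ (coefficient of u ∪ Ψ x) • p`
  have key : ∀ (x : complexBetti S (2 * 1)) (u : complexBetti Sg (2 * 1)),
      cupProduct (rfl : 2 * 1 + 2 * 1 = 2 * 2) x (Φ u) =
        (κ * (k3Form (η' u) (η' (Ψ x)) * (n' : ℂ))) • p := by
    intro x u
    -- the top class `W = fst^* u ∪ (snd^* x ∪ γ)`
    set W : complexBetti (MonoidalCategoryStruct.tensorObj Sg S) (2 * (2 + 2)) :=
      cupProduct (show 2 * 1 + (2 * 1 + 2 * 2) = 2 * (2 + 2) from rfl)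
        (complexBetti.map (SemiCartesianMonoidalCategory.fst Sg S) (2 * 1) u)
        (cupProduct (rfl : 2 * 1 + 2 * 2 = 2 * 1 + 2 * 2)
          (complexBetti.map (SemiCartesianMonoidalCategory.snd Sg S) (2 * 1) x) γ) with hWdef
    -- `fst₊ W = u ∪ Ψ x`
    have hfst : complexGysin μ hTT hSg_ (SemiCartesianMonoidalCategory.fst Sg S)
        (rfl : 2 * (2 + 2) + 2 * 2 = 2 * 2 + 2 * (2 + 2)) W =
        cupProduct (rfl : 2 * 1 + 2 * 1 = 2 * 2) u (Ψ x) := by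
      rw [hWdef, complexGysin_cup hμ hTT hSg_ (SemiCartesianMonoidalCategory.fst Sg S)
        (show 2 * 1 + (2 * 1 + 2 * 2) = 2 * (2 + 2) from rfl)
        (rfl : 2 * (2 + 2) + 2 * 2 = 2 * 2 + 2 * (2 + 2))
        (rfl : 2 * 1 + 2 * 2 + 2 * 2 = 2 * 1 + 2 * (2 + 2)) (rfl : 2 * 1 + 2 * 1 = 2 * 2) u _,
        hΨγ x]
    -- `W = snd^* x ∪ (fst^* u ∪ γ)` (associativity, graded commutativity in degrees `2, 2`)
    have hW' : W = cupProduct (show 2 * 1 + (2 * 1 + 2 * 2) = 2 * (2 + 2) from rfl)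
        (complexBetti.map (SemiCartesianMonoidalCategory.snd Sg S) (2 * 1) x)
        (cupProduct (rfl : 2 * 1 + 2 * 2 = 2 * 1 + 2 * 2)
          (complexBetti.map (SemiCartesianMonoidalCategory.fst Sg S) (2 * 1) u) γ) := by
      rw [hWdef, ← cupProduct_assoc (rfl : 2 * 1 + 2 * 1 = 2 * 2) (rfl : 2 * 1 + 2 * 2 = 2 * 1 + 2 * 2)
          (show 2 * 2 + 2 * 2 = 2 * (2 + 2) from rfl)
          (show 2 * 1 + (2 * 1 + 2 * 2) = 2 * (2 + 2) from rfl),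
        cupProduct_gradedComm_holds ℂ _ (rfl : 2 * 1 + 2 * 1 = 2 * 2) (rfl : 2 * 1 + 2 * 1 = 2 * 2)
          (complexBetti.map (SemiCartesianMonoidalCategory.fst Sg S) (2 * 1) u)
          (complexBetti.map (SemiCartesianMonoidalCategory.snd Sg S) (2 * 1) x),
        map_smul, LinearMap.smul_apply, Even.neg_one_pow (by decide : Even (2 * 1 * (2 * 1))), one_smul,
        cupProduct_assoc (rfl : 2 * 1 + 2 * 1 = 2 * 2) (rfl : 2 * 1 + 2 * 2 = 2 * 1 + 2 * 2)
          (show 2 * 2 + 2 * 2 = 2 * (2 + 2) from rfl)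
          (show 2 * 1 + (2 * 1 + 2 * 2) = 2 * (2 + 2) from rfl)]
    -- `snd₊ W = x ∪ Φ u`
    have hsnd : complexGysin μ hTT hS_ (SemiCartesianMonoidalCategory.snd Sg S)
        (rfl : 2 * (2 + 2) + 2 * 2 = 2 * 2 + 2 * (2 + 2)) W =
        cupProduct (rfl : 2 * 1 + 2 * 1 = 2 * 2) x (Φ u) := by
      rw [hW', complexGysin_cup hμ hTT hS_ (SemiCartesianMonoidalCategory.snd Sg S)
        (show 2 * 1 + (2 * 1 + 2 * 2) = 2 * (2 + 2) from rfl)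
        (rfl : 2 * (2 + 2) + 2 * 2 = 2 * 2 + 2 * (2 + 2))
        (rfl : 2 * 1 + 2 * 2 + 2 * 2 = 2 * 1 + 2 * (2 + 2)) (rfl : 2 * 1 + 2 * 1 = 2 * 2) x _,
        hΦ u, hact u]
    -- T1 on `W`
    have h1 := hκ W (k3Form (η' u) (η' (Ψ x)) * (n' : ℂ)) (by rw [hfst, hcg])
    rwa [hsnd] at h1
  -- the halving identity: `x ∪ Ψ⁻¹ u = ½ (coefficient of u ∪ Ψ x) • p`
  have half : ∀ (x : complexBetti S (2 * 1)) (u : complexBetti Sg (2 * 1)),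
      cupProduct (rfl : 2 * 1 + 2 * 1 = 2 * 2) x (Ψ.symm u) =
        ((k3Form (η' u) (η' (Ψ x)) * (n' : ℂ)) / 2) • p := by
    intro x u
    have h := hΨs u (Ψ x) ((k3Form (η' u) (η' (Ψ x)) * (n' : ℂ)) / 2)
      (by rw [hcg, mul_div_cancel₀ _ (two_ne_zero' ℂ)])
    rw [LinearEquiv.symm_apply_apply] at h
    rw [cupProduct_gradedComm_holds ℂ _ (rfl : 2 * 1 + 2 * 1 = 2 * 2) (rfl : 2 * 1 + 2 * 1 = 2 * 2)
        x (Ψ.symm u), h, Even.neg_one_pow (by decide : Even (2 * 1 * (2 * 1))), one_smul]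
  -- hence `x ∪ (Φ u - (2κ) • Ψ⁻¹ u) = 0` for all `x`, and by non-degeneracy `Φ u = (2κ) • Ψ⁻¹ u`
  have hΦΨ : ∀ u : complexBetti Sg (2 * 1), Φ u = ((2 : ℂ) * κ) • Ψ.symm u := by
    intro u
    have hzero : ∀ x : complexBetti S (2 * 1),
        cupProduct (rfl : 2 * 1 + 2 * 1 = 2 * 2) x (Φ u - ((2 : ℂ) * κ) • Ψ.symm u) = 0 := by
      intro x
      rw [map_sub, map_smul, key, half, smul_smul, ← sub_smul]
      convert zero_smul ℂ p using 2
      ring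
    -- read through the marking `η` of `S`
    have hform : ∀ w : K3Index → ℂ,
        k3Form w (η (Φ u - ((2 : ℂ) * κ) • Ψ.symm u)) = 0 := by
      intro w
      have h := hzero (η.symm w)
      rw [hcS, LinearEquiv.apply_symm_apply, smul_eq_zero] at h
      rcases h with h | h
      · exact (mul_eq_zero.1 h).resolve_right hn0
      · exact absurd h hp0
    have hη0 : η (Φ u - ((2 : ℂ) * κ) • Ψ.symm u) = 0 :=
      k3FormC_nondegenerate.2 _ fun w => by rw [k3FormC_apply]; exact hform w
    rw [LinearEquiv.map_eq_zero_iff] at hη0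
    exact sub_eq_zero.1 hη0
  -- `Ψ⁻¹ = (2κ)⁻¹ • Φ`, the action of the algebraic class `(2κ)⁻¹ • γ'`
  have h2κ : (2 : ℂ) * κ ≠ 0 := mul_ne_zero (two_ne_zero' ℂ) hκ0
  obtain ⟨γ'', hγ'', hΦ''⟩ := induced_smul
    (IsSmoothProjective.tensor_holds hS_ hSg_) hS_
    (rfl : 2 * 1 + 2 * 2 = 2 * 1 + 2 * 2) (rfl : 2 * 1 + 2 * 2 + 2 * 2 = 2 * 1 + 2 * (2 + 2))
    ((2 : ℂ) * κ)⁻¹ ⟨γ', hγ', hΦ⟩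
  refine ⟨γ'', hγ'', fun u => ?_⟩
  rw [← hΦ'' u, LinearMap.smul_apply, hΦΨ u, smul_smul, inv_mul_cancel₀ h2κ, one_smul]

end Summit.HodgeConjecture.HodgeConjecture.Theorems.NikulinTwinTransport

end
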